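import Literature.NumberTheory.EllipticCurves.ModPIrreducibleCongruenceTransferProofs
import Literature.NumberTheory.EllipticCurves.OpenImageMazurProofs
import Literature.NumberTheory.EllipticCurves.MinimalModelReduction
import Literature.NumberTheory.EllipticCurves.HasseWeilGoodReductionProofs
import Literature.NumberTheory.DiophantineGeometry.LocalReductionFiniteBadPlacesProofs
import Literature.NumberTheory.DiophantineGeometry.LocalReductionIsIntegralAtProofs
import Literature.NumberTheory.DiophantineGeometry.LocalReductionMinimalityProofs
import Literature.NumberTheory.GaloisRepresentations.IntegralGaloisActionProofs
import Literature.RingTheory.DiscreteValuationRing.AdicCompletionResidueField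
import Literature.RepresentationTheory.FiniteGroups.InvariantLineOfFixedVectors
import Mathlib.LinearAlgebra.Eigenspace.Charpoly
import HarnessLib

/-!
# Mazur's Frobenius certificate for the irreducibility of `E[ℓ]` over a NUMBER FIELD, and the trace of
# Frobenius of an `𝓞_K`-integral model read on its reduction

PROOF-ONLY file (0 definitions, 0 `Prop` facts, no instance, no notation) of the abc-iut cell (D-0079 RESCUE sub-cell
R-W, seat abc-iut-W-row-2, gen 5). Classical arithmetic of elliptic curves over number fields (Serre 1972, Mazur 1978,
Silverman AEC); TAKES NO SIDE on [IUTchIII] Cor. 3.12 or on any author. It generalises from `ℚ` to an arbitrary number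
field `K` the tree's `Summit.BirchSwinnertonDyer.Rank2.hasIrreducibleModPGaloisRep_map_of_noroot` /
`Rank1Residual.X12.irr_of_frobeniusTrace_of_forall_ne_zero` (Mazur 1978, Prop. 6.3 (1): a `Γ_ℚ`-stable line in
`E[p]` has an isogeny character `r` with `r(φ_ℓ)² − a_ℓ r(φ_ℓ) + ℓ = 0`), which the R-W table needs at NUMBER-FIELD
data of the `λ`-line (Broberg's point over `ℚ(√7)`, rows 9/10 of HOME/plan/rescue/R-W/OPEN-10.md: condition (P6) of
[IUTchIV] Cor. 2.2 (ii)). Every input is an existing tree THEOREM valid over any number field: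
`trace/det_galoisRepTate_frobenius_of_hasGoodReductionAt_holds` (`HasseWeilGoodReductionProofs`, Silverman C.21.3:
`tr(σ | T_ℓ E) = a_v`, `det = q_v` at an arithmetic Frobenius `σ` above a place `v ∤ ℓ` of good reduction),
`trace/det_galoisRepTorsion_eq_toZMod_…_galoisRepTate` (any field: `E[ℓ] = T_ℓ E / ℓ`), `Mazur1978.exists_isogenyCharacter`
(any field), `exists_isArithFrobAt_of_mem_primesAbove_holds` (any number field).

* §1 `sq_sub_trace_mul_add_det_eq_zero_of_eigenvector` — on an `𝔽`-plane an eigenvalue `c` of `f` satisfies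
  `c² − tr(f)c + det(f) = 0` (Cayley–Hamilton, Mathlib `Module.End.hasEigenvalue_iff_isRoot_charpoly`).
* §2 **`hasIrreducibleModPGaloisRep_of_frobeniusTraceAt_noroot`** — MAZUR'S FROBENIUS CERTIFICATE OVER `K`: for an
  elliptic curve `E/K`, a prime `ℓ`, a finite place `v ∤ ℓ` of good reduction, if `X² − a_v X + q_v` has no root
  mod `ℓ` then `E[ℓ]` is an irreducible `Γ_K`-module (`WeierstrassCurve.HasIrreducibleModPGaloisRep`).
* §3 `𝓞_K`-INTEGRAL MODELS `W₀` at a place `v` with `Δ(W₀) ∉ v`: good reduction, minimality, and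
  **`frobeniusTraceAt_baseChange_eq_of_Δ_not_mem`**: `a_v(W₀ ⊗ K) = #(𝓞_K/v) + 1 − #(W₀ mod v)(𝓞_K/v)` — the place-indexed
  trace of Frobenius (defined on Mathlib's chosen local minimal model over the completion) READ ON `W₀ mod v`
  (uniqueness of integral models, Silverman VII.1.3(b) `natCard_point_reduction_minimal`, and `𝓞_K/v ≅ κ(𝒪_v)`,
  `residueFieldEquiv`); `natCard_residueField_eq_natCard_quotient`.
* §4 **`hasIrreducibleModPGaloisRep_baseChange_of_certificate`** — the certificate in the shape a kernel computation
  supplies: `Δ(W₀) ∉ v`, `ℓ ∉ v`, and `X² − (N v + 1 − #(W₀ mod v)) X + N v` root-free mod `ℓ` ⇒ `(W₀ ⊗ K)[ℓ]` irreducible.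

[cite: Mazur1978, §5 p. 148 (isogeny character) and §6 Prop. 6.3 (1) p. 153] [cite: Serre1972, §2 and §4]
[cite: SilvermanAEC2009, VII.1 Prop. 1.3(b), VII.5 Prop. 5.1(a), C.21 Remark 21.3]
-/

noncomputable section

open scoped Classical NumberField
open IsDedekindDomain IsDedekindDomain.HeightOneSpectrum WeierstrassCurve Polynomial NumberField Field

namespace Summit.ABC.IUTFork

open Literature.NumberTheory.EllipticCurves Literature.NumberTheory.GaloisRepresentations

/-! ## §1 Plane linear algebra: an eigenvalue is a root of `X² − tr·X + det` -/

section Plane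

variable {k : Type*} [Field k] {V : Type*} [AddCommGroup V] [Module k V] [FiniteDimensional k V]

/-- On a `2`-dimensional space the characteristic polynomial of an endomorphism `f` is `X² − tr(f) X + det(f)`
(Mathlib `Matrix.charpoly_fin_two` in a basis). [folklore] -/
theorem charpoly_eq_of_finrank_eq_two (h2 : Module.finrank k V = 2) (f : Module.End k V) :
    f.charpoly = X ^ 2 - C (LinearMap.trace k V f) * X + C (LinearMap.det f) := by
  let b := Module.finBasisOfFinrankEq k V h2
  rw [← LinearMap.charpoly_toMatrix f b, Matrix.charpoly_fin_two,
    ← LinearMap.trace_eq_matrix_trace k b f, LinearMap.det_toMatrix b f]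

/-- **On a plane, an eigenvalue `c` of `f` (some `v ≠ 0` with `f v = c • v`) satisfies `c² − tr(f) c + det(f) = 0`**
(Cayley–Hamilton; Mathlib `Module.End.hasEigenvalue_iff_isRoot_charpoly`). [folklore] -/
theorem sq_sub_trace_mul_add_det_eq_zero_of_eigenvector (h2 : Module.finrank k V = 2) (f : Module.End k V)
    {c : k} {v : V} (hv0 : v ≠ 0) (hv : f v = c • v) :
    c ^ 2 - LinearMap.trace k V f * c + LinearMap.det f = 0 := by
  have h := Module.End.hasEigenvalue_iff_isRoot_charpoly f c
  rw [charpoly_eq_of_finrank_eq_two h2] at h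
  simp only [Polynomial.IsRoot.def, eval_add, eval_sub, eval_mul, eval_pow, eval_X, eval_C] at h
  exact h.mp (Module.End.hasEigenvalue_of_hasEigenvector ⟨Module.End.mem_eigenspace_iff.mpr hv, hv0⟩)

end Plane

/-! ## §2 Mazur's Frobenius certificate over a number field -/

section Certificate

variable {K : Type*} [Field K] [NumberField K] (W : WeierstrassCurve K) [W.IsElliptic] (ℓ : ℕ) [Fact ℓ.Prime]

/-- **Mazur's Frobenius certificate over a number field.** Let `E/K` be an elliptic curve over a number field, `ℓ` a
prime, `v` a finite place of `K` with `v ∤ ℓ` at which `E` has good reduction, `a_v = q_v + 1 − #Ẽ_v(k_v)` its trace of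
Frobenius (`WeierstrassCurve.frobeniusTraceAt`) and `q_v = #k_v`. If `X² − a_v X + q_v` has NO root in `𝔽_ℓ`, then the
`Γ_K`-module `E[ℓ]` is irreducible (`WeierstrassCurve.HasIrreducibleModPGaloisRep`; equivalently `E` admits no
`K`-rational `ℓ`-isogeny). Proof (Mazur 1978 Prop. 6.3 (1), verbatim over `K`): a `Γ_K`-stable line `⟨P⟩ ⊂ E[ℓ]`
carries an isogeny character `r : Γ_K → 𝔽_ℓ^×` (`Mazur1978.exists_isogenyCharacter`); at an arithmetic Frobenius `φ`
above `v` (`exists_isArithFrobAt_of_mem_primesAbove_holds`) the `𝔽_ℓ`-linear map `ρ̄(φ)` of the plane `E[ℓ]` has trace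
`a_v` and determinant `q_v` (Silverman C.21.3 on `T_ℓ E`, `trace/det_galoisRepTate_frobenius_of_hasGoodReductionAt_holds`,
reduced mod `ℓ` by `trace/det_galoisRepTorsion_eq_toZMod_…`) and the eigenvector `P` with eigenvalue `r(φ)`, whence
`r(φ)² − a_v r(φ) + q_v = 0` (§1). [cite: Mazur1978, §6 Prop. 6.3 (1) (p. 153)] [cite: SilvermanAEC2009, C.21 Remark 21.3] -/
theorem hasIrreducibleModPGaloisRep_of_frobeniusTraceAt_noroot (v : HeightOneSpectrum (𝓞 K))
    (hℓv : ((ℓ : ℕ) : 𝓞 K) ∉ v.asIdeal) (hgood : W.HasGoodReductionAt v)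
    (hnoroot : ∀ t : ZMod ℓ, t ^ 2 - (W.frobeniusTraceAt v : ZMod ℓ) * t +
      (Nat.card (IsLocalRing.ResidueField (v.adicCompletionIntegers K)) : ZMod ℓ) ≠ 0) :
    W.HasIrreducibleModPGaloisRep ℓ := by
  have hℓ : ℓ.Prime := Fact.out
  have hℓK : (ℓ : K) ≠ 0 := by exact_mod_cast hℓ.ne_zero
  haveI : NeZero (ℓ : K) := ⟨hℓK⟩
  by_contra hred
  obtain ⟨H, hHstab, hHcard⟩ :=
    (Mazur1978.not_hasIrreducibleModPGaloisRep_iff_exists_natCard_eq W ℓ).mp hred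
  obtain ⟨P, hP0, hHP⟩ := Mazur1978.exists_eq_zmultiples_of_natCard_eq W ℓ hHcard
  have hst : ∀ σ : absoluteGaloisGroup K, σ • P ∈ AddSubgroup.zmultiples P := fun σ ↦ by
    rw [← hHP]; exact hHstab σ P (hHP ▸ AddSubgroup.mem_zmultiples P)
  obtain ⟨r, hr⟩ := Mazur1978.exists_isogenyCharacter W ℓ hP0 hst
  obtain ⟨𝔓, h𝔓⟩ := v.primesAbove_nonempty
  obtain ⟨φ, hφ⟩ := HeightOneSpectrum.exists_isArithFrobAt_of_mem_primesAbove_holds (v := v) h𝔓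
  letI : Module (ZMod ℓ) (geomTorsion W ℓ) := AddSubgroup.torsionBy.zmodModule
  -- the plane `E[ℓ]`
  have hℓKb : (ℓ : AlgebraicClosure K) ≠ 0 := by exact_mod_cast hℓ.ne_zero
  have hcard : Nat.card (geomTorsion W ℓ) = ℓ ^ 2 :=
    card_torsionPoints_eq_sq_holds W (AlgebraicClosure K) (n := ℓ) hℓKb
  haveI : Finite (geomTorsion W ℓ) :=
    finite_torsionPoints_holds W (AlgebraicClosure K) (n := ℓ) (by exact_mod_cast hℓ.ne_zero)
  haveI : Module.Finite (ZMod ℓ) (geomTorsion W ℓ) := Module.Finite.of_finite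
  have h2 : Module.finrank (ZMod ℓ) (geomTorsion W ℓ) = 2 :=
    Literature.RepresentationTheory.FiniteGroups.Representation.finrank_eq_two_of_natCard_eq_sq hcard
  -- `ρ̄(φ)` as an `𝔽_ℓ`-linear map, its trace and determinant
  set f := (galoisRepTorsion W ℓ φ).toAdd.toAddMonoidHom.toZModLinearMap ℓ with hf
  have htr : LinearMap.trace (ZMod ℓ) _ f = (W.frobeniusTraceAt v : ZMod ℓ) := by
    rw [hf, trace_galoisRepTorsion_eq_toZMod_trace_galoisRepTate W ℓ hℓK φ,
      W.trace_galoisRepTate_frobenius_of_hasGoodReductionAt_holds ℓ v hℓv hgood h𝔓 hφ, map_intCast]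
  have hdet : LinearMap.det f =
      (Nat.card (IsLocalRing.ResidueField (v.adicCompletionIntegers K)) : ZMod ℓ) := by
    rw [hf, det_galoisRepTorsion_eq_toZMod_det_galoisRepTate W ℓ hℓK φ,
      W.det_galoisRepTate_frobenius_of_hasGoodReductionAt_holds ℓ v hℓv hgood h𝔓 hφ, map_natCast]
  -- `P` is an eigenvector of `ρ̄(φ)` with eigenvalue `r φ`
  have heig : f P = ((r φ : (ZMod ℓ)ˣ) : ZMod ℓ) • P := by
    have h1 : f P = φ • P := rfl
    rw [h1, hr φ, ← Nat.cast_smul_eq_nsmul (ZMod ℓ), ZMod.natCast_zmod_val]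
  have hroot := sq_sub_trace_mul_add_det_eq_zero_of_eigenvector h2 f hP0 heig
  rw [htr, hdet] at hroot
  exact hnoroot _ hroot

end Certificate

/-! ## §3 `𝓞_K`-integral models at a place not dividing the discriminant -/

section IntegralModel

variable {K : Type*} [Field K] [NumberField K] (W₀ : WeierstrassCurve (𝓞 K)) (v : HeightOneSpectrum (𝓞 K))

omit [NumberField K] in
/-- The discriminant of `W₀ ⊗ K` is the image of `Δ(W₀)`. [folklore] -/
theorem baseChange_Δ_eq : (W₀.baseChange K).Δ = algebraMap (𝓞 K) K W₀.Δ := by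
  rw [baseChange, map_Δ]

/-- If `Δ(W₀) ∉ v` then `v(Δ(W₀ ⊗ K)) = 1` (a `v`-unit). [folklore] -/
theorem valuation_Δ_baseChange_eq_one (hΔ : W₀.Δ ∉ v.asIdeal) : v.valuation K (W₀.baseChange K).Δ = 1 := by
  rw [baseChange_Δ_eq, valuation_of_algebraMap]
  exact intValuation_eq_one_iff.mpr hΔ

/-- **An `𝓞_K`-integral Weierstrass equation with `Δ ∉ v` has good reduction at `v`** (Silverman VII.5 Prop. 5.1(a),
VIII.1 Remark 1.3; tree `hasGoodReductionAt_of_valuation_Δ_eq_one_holds`). [cite: SilvermanAEC2009, VII.5 Prop. 5.1(a)] -/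
theorem hasGoodReductionAt_baseChange_of_Δ_not_mem (hΔ : W₀.Δ ∉ v.asIdeal) : (W₀.baseChange K).HasGoodReductionAt v :=
  hasGoodReductionAt_of_valuation_Δ_eq_one_holds v (W₀.baseChange K) (isIntegralAt_baseChange (v := v) W₀)
    (valuation_Δ_baseChange_eq_one W₀ v hΔ)

/-- An `𝓞_K`-integral Weierstrass equation with `Δ ∉ v` is a minimal equation at `v` (Silverman VII.1 Remark 1.1;
tree `isMinimalAt_of_lt_valuation_Δ_holds`). [cite: SilvermanAEC2009, VII.1 Remark 1.1] -/
theorem isMinimalAt_baseChange_of_Δ_not_mem (hΔ : W₀.Δ ∉ v.asIdeal) : (W₀.baseChange K).IsMinimalAt v :=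
  isMinimalAt_of_lt_valuation_Δ_holds (v := v) (W := W₀.baseChange K) (isIntegralAt_baseChange (v := v) W₀)
    (by rw [valuation_Δ_baseChange_eq_one W₀ v hΔ, ← WithZero.exp_zero]; exact WithZero.exp_lt_exp.mpr (by norm_num))

/-- `Δ(W₀ ⊗ K) ≠ 0` when `Δ(W₀) ∉ v` (for some place `v`). [folklore] -/
theorem Δ_baseChange_ne_zero_of_Δ_not_mem (hΔ : W₀.Δ ∉ v.asIdeal) : (W₀.baseChange K).Δ ≠ 0 := by
  intro h
  have h1 := valuation_Δ_baseChange_eq_one W₀ v hΔ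
  rw [h, map_zero] at h1
  exact zero_ne_one h1

/-- `W₀ ⊗ K` is an elliptic curve when `Δ(W₀) ∉ v` (for some place `v`). [folklore] -/
theorem isElliptic_baseChange_of_Δ_not_mem (hΔ : W₀.Δ ∉ v.asIdeal) : (W₀.baseChange K).IsElliptic :=
  ⟨isUnit_iff_ne_zero.mpr (Δ_baseChange_ne_zero_of_Δ_not_mem W₀ v hΔ)⟩

/-- `#κ(𝒪_v) = #(𝓞_K / v)` (`residueFieldEquiv`). [folklore] -/
theorem natCard_residueField_eq_natCard_quotient :
    Nat.card (IsLocalRing.ResidueField (v.adicCompletionIntegers K)) = Nat.card (𝓞 K ⧸ v.asIdeal) :=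
  natCard_residueField_adicCompletionIntegers K v

/-- The model `W₀` pushed to `𝒪_v` base-changes to `(W₀ ⊗ K) ⊗ K_v` (both are `W₀` pushed along `𝓞_K → K_v`). [folklore] -/
theorem baseChange_map_adicCompletionIntegers :
    (W₀.map (algebraMap (𝓞 K) (v.adicCompletionIntegers K))).baseChange (v.adicCompletion K) =
      (W₀.baseChange K).baseChange (v.adicCompletion K) := by
  rw [baseChange, baseChange, baseChange, WeierstrassCurve.map_map, WeierstrassCurve.map_map]
  rfl

/-- The residue map `𝓞_K → 𝒪_v → κ(𝒪_v)` is `residueFieldEquiv ∘ (𝓞_K → 𝓞_K/v)`. [folklore] -/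
theorem residue_comp_algebraMap_eq :
    (IsLocalRing.residue (v.adicCompletionIntegers K)).comp (algebraMap (𝓞 K) (v.adicCompletionIntegers K)) =
      ((residueFieldEquiv K v : 𝓞 K ⧸ v.asIdeal ≃+* IsLocalRing.ResidueField (v.adicCompletionIntegers K)) :
        𝓞 K ⧸ v.asIdeal →+* IsLocalRing.ResidueField (v.adicCompletionIntegers K)).comp (Ideal.Quotient.mk v.asIdeal) := by
  ext r
  simp [residueFieldEquiv_apply_mk]

/-- **The trace of Frobenius of an `𝓞_K`-integral model read on its reduction.** For `W₀` over `𝓞_K` and a finite place `v`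
with `Δ(W₀) ∉ v`: `a_v(W₀ ⊗ K) = #(𝓞_K/v) + 1 − #(W₀ mod v)(𝓞_K/v)`, where `a_v = WeierstrassCurve.frobeniusTraceAt` is
computed on Mathlib's chosen minimal model over the completion `𝒪_v`. The equation `W₀ ⊗ K_v` is itself `𝒪_v`-minimal
(`Δ` a unit), two minimal equations have isomorphic reductions (Silverman VII.1.3(b), tree `natCard_point_reduction_minimal`),
the `𝒪_v`-integral model of `W₀ ⊗ K_v` is `W₀` itself (`integralModel_eq_of_baseChange_eq`), and `κ(𝒪_v) ≅ 𝓞_K/v`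
(`residueFieldEquiv`, `natCard_point_map_ringEquiv`). [cite: SilvermanAEC2009, VII.1 Prop. 1.3(b) and C.§16] -/
theorem frobeniusTraceAt_baseChange_eq_of_Δ_not_mem (hΔ : W₀.Δ ∉ v.asIdeal) :
    (W₀.baseChange K).frobeniusTraceAt v =
      (Nat.card (𝓞 K ⧸ v.asIdeal) : ℤ) + 1 - Nat.card ((W₀.map (Ideal.Quotient.mk v.asIdeal)).toAffine.Point) := by
  set Ov := v.adicCompletionIntegers K with hOv
  set Kv := v.adicCompletion K with hKv
  set X := (W₀.baseChange K).baseChange Kv with hX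
  haveI hmin : X.IsMinimal Ov := isMinimalAt_baseChange_of_Δ_not_mem W₀ v hΔ
  have hΔX : X.Δ ≠ 0 := by
    rw [hX, baseChange, map_Δ]
    exact (_root_.map_ne_zero _).mpr (Δ_baseChange_ne_zero_of_Δ_not_mem W₀ v hΔ)
  haveI : (W₀.map (algebraMap (𝓞 K) Ov)).baseChange Kv |>.IsIntegral Ov := by
    rw [baseChange_map_adicCompletionIntegers]; infer_instance
  have hint : integralModel Ov X = W₀.map (algebraMap (𝓞 K) Ov) :=
    integralModel_eq_of_baseChange_eq X _ (baseChange_map_adicCompletionIntegers W₀ v)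
  rw [frobeniusTraceAt_def, natCard_residueField_eq_natCard_quotient]
  congr 2
  change Nat.card ((X.minimal Ov).reduction Ov).toAffine.Point = _
  rw [natCard_point_reduction_minimal X hΔX, reduction, hint, WeierstrassCurve.map_map, residue_comp_algebraMap_eq,
    ← WeierstrassCurve.map_map, natCard_point_map_ringEquiv]

end IntegralModel

/-! ## §4 The certificate in kernel-computable shape -/

section KernelShape

variable {K : Type*} [Field K] [NumberField K] (W₀ : WeierstrassCurve (𝓞 K)) (ℓ : ℕ) [Fact ℓ.Prime]
  (v : HeightOneSpectrum (𝓞 K))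

/-- **Mazur's Frobenius certificate over a number field, read on an `𝓞_K`-integral model.** Let `W₀` be a Weierstrass
equation over `𝓞_K`, `ℓ` a prime and `v` a finite place with `Δ(W₀) ∉ v` and `ℓ ∉ v`; put `N = #(𝓞_K/v)` and
`n = #(W₀ mod v)(𝓞_K/v)` (affine points over `𝓞_K/v` plus `O`). If `X² − (N + 1 − n) X + N` has no root mod `ℓ`, then the
`ℓ`-torsion of the elliptic curve `W₀ ⊗ K` is an irreducible `Γ_K`-module. (§2 with §3.)
[cite: Mazur1978, §6 Prop. 6.3 (1) (p. 153)] -/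
theorem hasIrreducibleModPGaloisRep_baseChange_of_certificate (hΔ : W₀.Δ ∉ v.asIdeal)
    (hℓv : ((ℓ : ℕ) : 𝓞 K) ∉ v.asIdeal)
    (hnoroot : ∀ t : ZMod ℓ, t ^ 2 - (((Nat.card (𝓞 K ⧸ v.asIdeal) : ℤ) + 1 -
        Nat.card ((W₀.map (Ideal.Quotient.mk v.asIdeal)).toAffine.Point) : ℤ) : ZMod ℓ) * t +
      (Nat.card (𝓞 K ⧸ v.asIdeal) : ZMod ℓ) ≠ 0) :
    (W₀.baseChange K).HasIrreducibleModPGaloisRep ℓ := by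
  haveI := isElliptic_baseChange_of_Δ_not_mem W₀ v hΔ
  refine hasIrreducibleModPGaloisRep_of_frobeniusTraceAt_noroot (W₀.baseChange K) ℓ v hℓv
    (hasGoodReductionAt_baseChange_of_Δ_not_mem W₀ v hΔ) ?_
  rw [frobeniusTraceAt_baseChange_eq_of_Δ_not_mem W₀ v hΔ, natCard_residueField_eq_natCard_quotient]
  exact hnoroot

end KernelShape

end Summit.ABC.IUTFork

end
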